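import Literature.AlgebraicGeometry.Frobenioids.QuasiTemperoidPushforward
import Literature.AnabelianGeometry.EtaleTheta.Discharge.Sec4GaloisSurjNaturalModel
import HarnessLib

/-!
# [EtTh] §3 p.298 / §5 p.329: geometric automorphisms act as the identity in the constant-field category
# `D^cnst` — the content of the binder `hΔcnst` (GAP-LEDGER G-w5d020-2) PROVED at the CONSTRUCTED functor `D₀ → D^cnst`

S. Mochizuki, *The étale theta function and its Frobenioid-theoretic manifestations*, Publ. RIMS **45** (2009)
[MochizukiEtTh2009], §3, PRIMS p.298 (PDF p.72): "`D₀ := B^temp(X^log)⁰`; `D^cnst := B(Spec(K))⁰` … Also, we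
observe that the natural surjection `Π^tp_X ↠ G_K` determines a natural functor `D₀ → D^cnst` [cf. [FrdII],
Example 1.3, (ii)]"; and S. Mochizuki, *The geometry of Frobenioids II*, Kyushu J. Math. **62** (2008)
[MochizukiFrdII2008], Example 1.3 (ii) p.11: for a surjective open `φ : Π₁ ↠ Π₂` the functor
`φ_* : B^temp(Π₁)⁰ → B^temp(Π₂)⁰`, "`E ↦ E/Ker(φ)`".

abc-iut cell, layer L2, L2-lead ROWS #12-addendum (R98) (2)(i) → seat abc-iut-w5-d118; GAP-LEDGER row
**G-w5d020-2** (binder `hΔcnst` of abc-iut-w5-d020's `ThetaFrobenioid.hconst_ofBiKummerData_of_cnst`,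
`Discharge/Sec5UnitsFixedByGeometricOfCnst.lean`): "for `δ ∈ Ker(Π^tp_X ↠ G_K)`, the constant-field functor
`cnst` sends the geometric automorphism `ρ_N(δ)` of the Galois base object `B_N^bs` to the identity".

SIZING ANSWER (the lead's question "does the tree hold a CONSTRUCTED constant-field functor determined by
`Π^tp_X ↠ G_K`?"): YES — it is [FrdII] Ex. 1.3 (ii)'s `φ_*`, constructed by the abc-iut-L1-t4 lineage as
`Frobenioids.QuasiTemperoid.orbits φ hs hφ : B^temp(Π₁) ⥤ B^temp(Π₂)` (`E ↦ E/Ker(φ)`) with its connected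
restriction `QuasiTemperoid.pushforward φ hs hφ : B^temp(Π₁)⁰ ⥤ B^temp(Π₂)⁰` (`QuasiTemperoidPushforward.lean`);
at `φ := (Π^tp_X ↠ G_K)` this IS print's `D₀ → D^cnst` (`D₀ = B^temp(Π^tp_X)⁰`; `D^cnst = B(Spec K)⁰ = B(G_K)⁰`,
and for the compact `G_K` the connected objects of `B^temp(G_K)` are the finite `G_K/H`, `H` open).  The
geometric automorphisms are the images of `Ker(φ)` under the Galois surjection `Π ↠ Aut(A)` of a Galois
object ([EtTh] Def. 4.1 (ii); abc-iut-w5-d013's `GaloisObjects.galoisSurjOf`, [SemiAnbd] Rmk. 3.1.3).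

PROVED here (proof-only, 0 definitions, no named fact):

* `orbits_map_eq_id_of_mem_ker_orbit` — an endomorphism `f` of a `Π₁`-set `E` that moves every point inside
  its own `Ker(φ)`-orbit induces the identity of `E/Ker(φ)`;
* `orbits_map_galoisSurjOf_eq_id` — **for a Galois object `A` of `B^temp(Π₁)` and `δ ∈ Ker(φ)`,
  `φ_*(galoisSurjOf_A(δ)) = 𝟙`**: with `A ≅ Π₁/N` and base point `x_A`, `galoisSurjOf_A(δ)(a·x_A) =
  (a δ⁻¹)·x_A = (a δ⁻¹ a⁻¹)·(a·x_A)` and `a δ⁻¹ a⁻¹ ∈ Ker(φ)` (normality) — print's "geometric automorphisms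
  become identities in `D^cnst`";
* `orbits_map_conjAut_galoisSurjOf_eq_id` — the same after transport along any isomorphism `e : A ≅ B`
  (the §5 data use `ρ_N(δ) := e.conjAut (galoisSurj(δ))`, `e = (NthRoot.baseIso)`);
* `pushforward_map_galoisSurjOf_eq_id` — the `B^temp(Π₁)⁰ → B^temp(Π₂)⁰` form (print's `D₀ → D^cnst`).

WHAT REMAINS for the literal binder `hΔcnst` of p425781 (one `rw` away, not doable before the datum exists):
the §5 data assembled over a §4 setting `S` whose base functor `S.tf.base : D ⥤ D₀` lands in the GENUINE
`D₀ := ConnectedPart (BTemp X.Pi)` with `cnst := pushforward X.aug …` and `S.galoisSurj = galoisSurjOf`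
(abc-iut-L2-t4's W3-L2-01 genuine tempered Frobenioid; over the full `BTemp X.Pi` every such datum is
vacuous, abc-iut-w4-d099 `Sec3TemperedFrobenioidBTempVacuity`), together with the identification
`X.aug (ιX δ) = 1` for `δ ∈ Ker(T.aug)` of the §2 datum and the openness of `Π^tp_X ↠ G_K`.
HONEST FRAMING: plain topological-group / `Π`-set theory over refereed [FrdII]/[SemiAnbd]/[EtTh] §3 vocabulary;
nothing here bears on, or takes a side on, [IUTchIII] Cor. 3.12; typed ≠ proved for the named binders.
-/

noncomputable section

open CategoryTheory Topology

namespace Literature.AlgebraicGeometry.Frobenioids.QuasiTemperoid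

open Literature.AnabelianGeometry.SemiGraphs Literature.AnabelianGeometry.SemiGraphs.GaloisObjects
  Literature.AlgebraicGeometry.Frobenioids.QuasiTemperoid.BTempConnected

universe u

variable {G₁ : Type u} [Group G₁] [TopologicalSpace G₁] [IsTopologicalGroup G₁] {G₂ : Type u} [Group G₂]
  [TopologicalSpace G₂] (φ : G₁ →* G₂) (hs : Function.Surjective φ) (hφ : IsOpenMap φ)

/-! ### Endomorphisms moving points inside their `Ker(φ)`-orbits die in `E/Ker(φ)` -/

/-- An endomorphism `f` of a `Π₁`-set `E ∈ Ob(B^temp(Π₁))` which moves every point inside its own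
`Ker(φ)`-orbit (`f x = k_x · x`, `φ(k_x) = 1`) induces the IDENTITY of `φ_*(E) = E/Ker(φ)`.
[cite: MochizukiFrdII2008, Ex 1.3 (ii) p.11] -/
theorem orbits_map_eq_id_of_mem_ker_orbit {X : BTemp G₁} (f : X ⟶ X)
    (hf : ∀ x : X.obj.V, ∃ k : G₁, φ k = 1 ∧ X.obj.ρ k x = f.hom.hom x) :
    (orbits φ hs hφ).map f = 𝟙 _ := by
  apply hom_ext_apply
  intro q
  induction q using Quotient.ind with
  | _ x =>
    change (orbitMk (f.hom.hom x) : OrbitSet φ X) = orbitMk x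
    obtain ⟨k, hk, hkx⟩ := hf x
    exact (orbitMk_eq_iff.mpr ⟨k, hk, hkx⟩).symm

/-- Transport along an isomorphism: if `σ ∈ Aut(A)` dies in `E/Ker(φ)`, so does `e.conjAut σ ∈ Aut(B)` for any
`e : A ≅ B` (functoriality of `φ_*`). [cite: MochizukiFrdII2008, Ex 1.3 (ii) p.11] -/
theorem orbits_map_conjAut_eq_id {A B : BTemp G₁} (e : A ≅ B) (σ : Aut A)
    (hσ : (orbits φ hs hφ).map σ.hom = 𝟙 _) : (orbits φ hs hφ).map (e.conjAut σ).hom = 𝟙 _ := by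
  rw [Iso.conjAut_hom, Iso.conj_apply, Functor.map_comp, Functor.map_comp, hσ, Category.id_comp,
    ← Functor.map_comp, Iso.inv_hom_id, CategoryTheory.Functor.map_id]

/-! ### Geometric automorphisms of a Galois object die in `D^cnst` ([EtTh] §3 p.298) -/

variable (hG : IsTempered G₁)

/-- **Geometric automorphisms act as the identity in the constant-field category** ([EtTh] §3 p.298 (PDF p.72):
"the natural surjection `Π^tp_X ↠ G_K` determines a natural functor `D₀ → D^cnst`"; used in the proof of Thm. 5.6,
p.329 (PDF p.103)): for a Galois object `A` of `B^temp(Π₁)` ([SemiAnbd] Def. 3.1 (iv)), the Galois surjection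
`galoisSurjOf_A : Π₁ ↠ Aut(A)` ([EtTh] Def. 4.1 (ii); [SemiAnbd] Rmk. 3.1.3) and `δ ∈ Ker(φ)`, the functor
`φ_* = (E ↦ E/Ker(φ))` of [FrdII] Ex. 1.3 (ii) sends `galoisSurjOf_A(δ)` to the identity.  Reason:
`galoisSurjOf_A(δ)(a·x_A) = (a δ⁻¹)·x_A = (a δ⁻¹ a⁻¹)·(a·x_A)` with `a δ⁻¹ a⁻¹ ∈ Ker(φ)`.
[cite: MochizukiEtTh2009, §3 p.298 (PDF p.72)] -/
theorem orbits_map_galoisSurjOf_eq_id (A : BTemp G₁) (hA : IsGaloisObj A) {δ : G₁} (hδ : φ δ = 1) :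
    (orbits φ hs hφ).map (galoisSurjOf hG A hA δ).hom = 𝟙 _ := by
  refine orbits_map_eq_id_of_mem_ker_orbit φ hs hφ _ fun x => ?_
  obtain ⟨a, rfl⟩ := exists_ρ_galoisBase_eq hG A hA x
  refine ⟨a * δ⁻¹ * a⁻¹, ?_, ?_⟩
  · rw [map_mul, map_mul, map_inv, map_inv, hδ, inv_one, mul_one, mul_inv_cancel]
  · rw [galoisSurjOf_apply, ← ρ_mul_apply, inv_mul_cancel_right]

/-- The same for the TRANSPORTED automorphism `e.conjAut (galoisSurjOf_A(δ))` of an isomorphic object `B` — the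
shape `ρ_N(δ) := (baseIso).conjAut (galoisSurj (ιX δ))` of the §5 data (`rhoOfBiKummerData`).
[cite: MochizukiEtTh2009, §3 p.298 (PDF p.72)] -/
theorem orbits_map_conjAut_galoisSurjOf_eq_id (A : BTemp G₁) (hA : IsGaloisObj A) {B : BTemp G₁} (e : A ≅ B)
    {δ : G₁} (hδ : φ δ = 1) : (orbits φ hs hφ).map (e.conjAut (galoisSurjOf hG A hA δ)).hom = 𝟙 _ :=
  orbits_map_conjAut_eq_id φ hs hφ e _ (orbits_map_galoisSurjOf_eq_id φ hs hφ hG A hA hδ)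

/-- **Print's form, on the connected parts `D₀ = B^temp(Π₁)⁰ → B^temp(Π₂)⁰ = D^cnst`**: for a Galois object `A`
of `B^temp(Π₁)⁰` and `δ ∈ Ker(φ)`, the functor `φ_*` of [FrdII] Ex. 1.3 (ii) (`QuasiTemperoid.pushforward`) sends
the automorphism `galoisSurjOf_A(δ)` (viewed in the full subcategory) to the identity of `A^cnst`.
[cite: MochizukiEtTh2009, §3 p.298 (PDF p.72)] -/
theorem pushforward_map_galoisSurjOf_eq_id (A : ConnectedPart (BTemp G₁)) (hA : IsGaloisObj A.obj) {δ : G₁}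
    (hδ : φ δ = 1) :
    (pushforward φ hs hφ).map ((connectedObjects (BTemp G₁)).isoMk (galoisSurjOf hG A.obj hA δ)).hom = 𝟙 _ := by
  apply ObjectProperty.hom_ext
  change (orbits φ hs hφ).map (galoisSurjOf hG A.obj hA δ).hom = 𝟙 ((orbits φ hs hφ).obj A.obj)
  exact orbits_map_galoisSurjOf_eq_id φ hs hφ hG A.obj hA hδ

/-- The connected-part form for the transported automorphism `e.conjAut (galoisSurjOf_A(δ))`, `e : A ≅ B` an
isomorphism of `B^temp(Π₁)⁰`. [cite: MochizukiEtTh2009, §3 p.298 (PDF p.72)] -/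
theorem pushforward_map_conjAut_galoisSurjOf_eq_id (A B : ConnectedPart (BTemp G₁)) (hA : IsGaloisObj A.obj)
    (e : A ≅ B) {δ : G₁} (hδ : φ δ = 1) :
    (pushforward φ hs hφ).map
        (e.conjAut ((connectedObjects (BTemp G₁)).isoMk (galoisSurjOf hG A.obj hA δ))).hom = 𝟙 _ := by
  rw [Iso.conjAut_hom, Iso.conj_apply, Functor.map_comp, Functor.map_comp,
    pushforward_map_galoisSurjOf_eq_id φ hs hφ hG A hA hδ, Category.id_comp, ← Functor.map_comp, Iso.inv_hom_id,
    CategoryTheory.Functor.map_id]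

end Literature.AlgebraicGeometry.Frobenioids.QuasiTemperoid
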